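import Summits.QuantumFields.YangMills.Theorems.BalabanUVNodesN21HistoriesMarginalEnvelopes

/-!
# N21 (NE7c) · histories road: the one-run level ledger from TERM DOMINANTS (lens junction #2, Card 40)

R134 seat pub-ymgap-dag-n21-d (g7), node N21 = NE7c (single-run shell-weight bound, NOT PRINTED in [Bałaban 1983–89],
NOT proved), lane K3⁶ `SpineGivenEndpointR13SepCoPR` (stmt-QuantumFields-20509, `--kind proof --supports … --as helper`).

THIS FILE = LENS ROW K of `ym-lens-BalabanUVNodes-nearmiss/LENS-nearmiss.md` v14.0∕v15.0 (first refusal dag-n21-d as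
the module-20 owner): the §K1–§K3 sections of the lens's `Sketch-nearmiss-g14.lean` (sha16 56906906810b2821, farm rc 0 · 0
warnings at the lens desk) VERBATIM — statements and proofs — re-homed in this namespace with this credit header;
AUTHORSHIP OF THE MATHEMATICS: planner seat `ym-lens-BalabanUVNodes-nearmiss` g14 (memo-only seat, cannot file); this
seat only files.  CONTENT: module 20 (`N21SelectedThresholdsHistories.levelLedger_histories_of_goodAssignment`, this
seat g5) feeds END-I's level ledger from three binders per window slot `s` — a finite LAW with (M1) along `u_s`, an
ENVELOPE `partialLaw_s ≤ M₁ • law` and a MASS comparison; §K1 `partialLaw_le_sum_termLaws` ∕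
`partialLaw_le_smul_sum_dominants` discharge the envelope from term dominants `ν_τ ≤ M • ν̄_τ` (the tilt-sandwich
species of modules 23b∕23c), §K2 `histWeight_ge_of_unionBound` discharges the mass comparison from the per-term UNION
BOUND `Σ_{s ∈ small τ} ν_τ{a_s ≤ u_s} ≤ q·ν_τ(univ)`, and §K3 `levelLedger_histories_of_termDominants` is the END-TO-END
one-run ledger with law `Σ_{τ ∋ s} ν̄_τ` and constant `D_j = M₁M₃∕(1 − q)·D′_j`, the (M1) binder now reading «the
tilt-free dominants of the `s`-small histories, summed, are anti-concentrated along `u_s` at the slot's threshold».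
Imports dag-n21-e's 20m `BalabanUVNodesN21HistoriesMarginalEnvelopes` (p520902 ✓) as the sketch does.

HONEST FRAMING.  Pure measure theory ∕ real arithmetic, [folklore], 0 def, 0 sorry; nothing of Bałaban's asserted;
every located input (the dominations `hdomU`∕`hdomL`, the union bound `hunion`, the (M1) residual `hgood`) is a
HYPOTHESIS.  NE7c NOT PRINTED ∕ NOT proved; N21 NOT discharged; counts unmoved (typed 28∕28 · discharged 5∕27);
count-neutral; one finite 𝕋⁴ at fixed ε — nothing about ℝ⁴ ∕ OS ∕ mass gap ∕ Clay.
-/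

open MeasureTheory Set Function
open scoped ENNReal NNReal

namespace Summit.QuantumFields.YangMills.Theorems.N21HistoriesTermDominants

open Literature.MathematicalPhysics.QuantumFieldTheory.Balaban1983to89
open Literature.MathematicalPhysics.QuantumFieldTheory.Balaban1983to89.T4ShellMeasure (SlotAntiConcentration)
open T4ShellMeasureLevels (LevelLedger)
open Summit.QuantumFields.BalabanUV.T4Continuum.ShellMeasureRootCompositionHistories
open Summit.QuantumFields.YangMills.Theorems.N21SelectedThresholdsHistories (levelLedger_histories_of_goodAssignment)
open Summit.QuantumFields.YangMills.Theorems.N21HistoriesAbsorbingDefs (histLaw_eq_restrict)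
open Summit.QuantumFields.YangMills.Theorems.N21HistoriesWindowedModelADefs (smallEvent measurableSet_smallEvent)

/-! ## §K1 the partial law is below the sum of the `s`-small TERM laws; envelopes from term dominants -/

section Envelope

variable {Ω σ ι : Type*} [MeasurableSpace Ω] [DecidableEq σ]

/-- **`μ_s ≤ Σ_{τ ∋ s} ν_τ`**: the `s`-small partial law (own indicators kept) never exceeds the plain sum of the
`s`-small term laws (`histLaw ν = ν|E ≤ ν`). [folklore] -/
theorem partialLaw_le_sum_termLaws (T : Finset ι) (ν : ι → Measure Ω) (small : ι → Finset σ) {u : σ → Ω → ℝ}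
    (hu : ∀ s, Measurable (u s)) (ϑ : σ → ℝ) (s : σ) :
    partialLaw T ν small u ϑ s ≤ ∑ τ ∈ T.filter (fun τ => s ∈ small τ), ν τ := by
  rw [partialLaw, Measure.le_iff']
  intro E
  rw [Measure.finsetSum_apply, Measure.finsetSum_apply]
  exact Finset.sum_le_sum fun τ _ => by
    rw [histLaw_eq_restrict (ν τ) (small τ) hu ϑ]
    exact Measure.le_iff'.1 Measure.restrict_le_self E

/-- **THE ENVELOPE FROM TERM DOMINANTS**: if every `s`-small term law is dominated `ν_τ ≤ M • ν̄_τ` (tilt sandwich ∕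
threshold-free dominant), then `μ_s ≤ M • Σ_{τ ∋ s} ν̄_τ` — module 20's `henv` for the law `Σ_{τ ∋ s} ν̄_τ`. [folklore] -/
theorem partialLaw_le_smul_sum_dominants (T : Finset ι) (ν νbar : ι → Measure Ω) (small : ι → Finset σ)
    {u : σ → Ω → ℝ} (hu : ∀ s, Measurable (u s)) (ϑ : σ → ℝ) (s : σ) {M : ℝ≥0∞}
    (hdom : ∀ τ ∈ T, s ∈ small τ → ν τ ≤ M • νbar τ) :
    partialLaw T ν small u ϑ s ≤ M • ∑ τ ∈ T.filter (fun τ => s ∈ small τ), νbar τ := by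
  refine (partialLaw_le_sum_termLaws T ν small hu ϑ s).trans ?_
  rw [Finset.smul_sum, Measure.le_iff']
  intro E
  rw [Measure.finsetSum_apply, Measure.finsetSum_apply]
  exact Finset.sum_le_sum fun τ hτ =>
    Measure.le_iff'.1 (hdom τ (Finset.mem_filter.1 hτ).1 (Finset.mem_filter.1 hτ).2) E

end Envelope

/-! ## §K2 the per-term UNION BOUND is the mass binder -/

section UnionBound

variable {Ω σ : Type*} [MeasurableSpace Ω]

/-- `A_τ = ν_τ(E_τ)`: a history's weight is the mass of its own small event. [folklore] -/
theorem histWeight_eq_measure_smallEvent (ν : Measure Ω) [IsFiniteMeasure ν] (sm : Finset σ) {u : σ → Ω → ℝ}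
    (hu : ∀ s, Measurable (u s)) (ϑ : σ → ℝ) :
    histWeight ν sm u ϑ = (ν (smallEvent sm u ϑ)).toReal := by
  rw [← histLaw_univ_toReal ν sm hu ϑ, histLaw_eq_restrict ν sm hu ϑ, Measure.restrict_apply_univ]

/-- Bonferroni: `ν(univ) ≤ ν(E) + Σ_{s ∈ sm} ν{ϑ_s ≤ u_s}`. [folklore] -/
theorem measure_univ_le_smallEvent_add (ν : Measure Ω) (sm : Finset σ) (u : σ → Ω → ℝ) (ϑ : σ → ℝ) :
    ν univ ≤ ν (smallEvent sm u ϑ) + ∑ s ∈ sm, ν {ω | ϑ s ≤ u s ω} := by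
  have hcover : (univ : Set Ω) ⊆ smallEvent sm u ϑ ∪ ⋃ s ∈ sm, {ω | ϑ s ≤ u s ω} := by
    intro ω _
    by_cases h : ω ∈ smallEvent sm u ϑ
    · exact Or.inl h
    · right
      simp only [smallEvent, mem_setOf_eq, not_forall, not_lt] at h
      obtain ⟨s, hs, hle⟩ := h
      exact mem_biUnion hs hle
  calc ν univ ≤ ν (smallEvent sm u ϑ ∪ ⋃ s ∈ sm, {ω | ϑ s ≤ u s ω}) := measure_mono hcover
    _ ≤ ν (smallEvent sm u ϑ) + ν (⋃ s ∈ sm, {ω | ϑ s ≤ u s ω}) := measure_union_le _ _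
    _ ≤ ν (smallEvent sm u ϑ) + ∑ s ∈ sm, ν {ω | ϑ s ≤ u s ω} := by
        gcongr
        exact measure_biUnion_finset_le sm _

/-- **THE MASS BINDER FROM THE UNION BOUND**: `Σ_{s ∈ sm} ν{ϑ_s ≤ u_s} ≤ q·ν(univ) ⟹ (1 − q)·ν(univ) ≤ A_τ`
(the (MR)∕`hfail`+`hm` species of `T4ShellMeasureLocal`, per history). [folklore] -/
theorem histWeight_ge_of_unionBound (ν : Measure Ω) [IsFiniteMeasure ν] (sm : Finset σ) {u : σ → Ω → ℝ}
    (hu : ∀ s, Measurable (u s)) (ϑ : σ → ℝ) {q : ℝ}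
    (hunion : ∑ s ∈ sm, (ν {ω | ϑ s ≤ u s ω}).toReal ≤ q * (ν univ).toReal) :
    (1 - q) * (ν univ).toReal ≤ histWeight ν sm u ϑ := by
  rw [histWeight_eq_measure_smallEvent ν sm hu ϑ]
  have hne : ∀ s ∈ sm, ν {ω | ϑ s ≤ u s ω} ≠ ∞ := fun s _ => measure_ne_top ν _
  have h' : (ν univ).toReal ≤ (ν (smallEvent sm u ϑ)).toReal + ∑ s ∈ sm, (ν {ω | ϑ s ≤ u s ω}).toReal := by
    rw [← ENNReal.toReal_sum hne, ← ENNReal.toReal_add (measure_ne_top ν _) (ENNReal.sum_ne_top.2 hne)]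
    exact ENNReal.toReal_mono (ENNReal.add_ne_top.2 ⟨measure_ne_top ν _, ENNReal.sum_ne_top.2 hne⟩)
      (measure_univ_le_smallEvent_add ν sm u ϑ)
  have hq : (1 - q) * (ν univ).toReal = (ν univ).toReal - q * (ν univ).toReal := by ring
  linarith

end UnionBound

/-! ## §K3 END-TO-END: module 20's one-run ledger with the law «tilt-free dominants of the `s`-small histories, summed» -/

section OneRun

variable {Ω : ℕ → Type*} [∀ K, MeasurableSpace (Ω K)] {σ ι : Type*} [DecidableEq σ]
  {T : ℕ → Finset ι} {C : ℕ → Finset σ} {small : ℕ → ι → Finset σ} {lvl : ℕ → σ → ℕ}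
  {ν : ∀ K : ℕ, (ℕ → ℝ) → ℝ → ι → Measure (Ω K)} [∀ K a t τ, IsFiniteMeasure (ν K a t τ)]
  {νbar : ∀ K : ℕ, (ℕ → ℝ) → ι → Measure (Ω K)} [∀ K a τ, IsFiniteMeasure (νbar K a τ)]
  {u v : ∀ K : ℕ, σ → Ω K → ℝ} {ρ D' : ℕ → ℝ} {l₀ M₁ M₃ q : ℝ}

/-- **ONE RUN FROM TERM DOMINANTS.**  Module 20's `levelLedger_histories_of_goodAssignment` with the law of slot `s`
:= `Σ_{τ ∈ T K, s ∈ small K τ} ν̄ K a τ` (any tilt-free family dominating the tilted term laws from above with loss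
`M₁` and of comparable total mass, loss `M₃`), the per-history UNION BOUND with ratio `q < 1`, and (M1) for that law
along `u_s` at the slot's threshold — conclusion module 20's, constant `D_j = M₁ M₃∕(1 − q) · D′_j`. [folklore] -/
theorem levelLedger_histories_of_termDominants (a : ℕ → ℕ → ℝ)
    (hu : ∀ K s, Measurable (u K s)) (hv : ∀ K s, Measurable (v K s))
    (hsmall : ∀ K, ∀ τ ∈ T K, small K τ ⊆ C K)
    (hgood : ∀ K, ∀ s ∈ C K, SlotAntiConcentration (∑ τ ∈ (T K).filter (fun τ => s ∈ small K τ), νbar K (a K) τ)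
      (u K s) (a K (lvl K s)) (ρ (lvl K s)) (D' (lvl K s)))
    (hD' : ∀ j, 0 ≤ D' j) (hρ0 : ∀ j, 0 ≤ ρ j) (hM₁ : 0 ≤ M₁) (hM₃ : 0 < M₃) (hq : q < 1)
    (hclose : ∀ K t, |t| ≤ l₀ → ∀ τ ∈ T K, ∀ s ∈ small K τ,
      ∀ᵐ ω ∂(ν K (a K) t τ), |u K s ω - v K s ω| ≤ ρ (lvl K s) * a K (lvl K s))
    (hdomU : ∀ K t, |t| ≤ l₀ → ∀ τ ∈ T K, ν K (a K) t τ ≤ ENNReal.ofReal M₁ • νbar K (a K) τ)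
    (hdomL : ∀ K t, |t| ≤ l₀ → ∀ τ ∈ T K, (νbar K (a K) τ univ).toReal ≤ M₃ * (ν K (a K) t τ univ).toReal)
    (hunion : ∀ K t, |t| ≤ l₀ → ∀ τ ∈ T K,
      ∑ s ∈ small K τ, (ν K (a K) t τ {ω | a K (lvl K s) ≤ u K s ω}).toReal ≤ q * (ν K (a K) t τ univ).toReal) :
    LevelLedger l₀ T (fun K t τ => histWeight (ν K (a K) t τ) (small K τ) (u K) (fun s => a K (lvl K s)))
      (fun K t τ => histShell (ν K (a K) t τ) (small K τ) (u K) (v K) (fun s => a K (lvl K s))) C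
      (fun K t s τ => histPiece (ν K (a K) t τ) (small K τ) (u K) (v K) (fun s => a K (lvl K s)) s) lvl
      (fun j => M₁ / ((1 - q) / M₃) * D' j) ρ := by
  have hM₂ : 0 < (1 - q) / M₃ := div_pos (by linarith) hM₃
  refine levelLedger_histories_of_goodAssignment
    (law := fun K b s => ∑ τ ∈ (T K).filter (fun τ => s ∈ small K τ), νbar K b τ)
    a hu hv hsmall hgood hD' hρ0 hM₁ hM₂ hclose ?_ ?_
  · intro K t ht s _
    exact partialLaw_le_smul_sum_dominants (T K) (ν K (a K) t) (νbar K (a K)) (small K) (hu K) _ s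
      fun τ hτ _ => hdomU K t ht τ hτ
  · intro K t ht s _
    have hterm : ∀ τ ∈ T K, (1 - q) / M₃ * (νbar K (a K) τ univ).toReal ≤
        histWeight (ν K (a K) t τ) (small K τ) (u K) (fun s => a K (lvl K s)) := by
      intro τ hτ
      have h1 := histWeight_ge_of_unionBound (ν K (a K) t τ) (small K τ) (hu K) (fun s => a K (lvl K s))
        (hunion K t ht τ hτ)
      calc (1 - q) / M₃ * (νbar K (a K) τ univ).toReal ≤ (1 - q) / M₃ * (M₃ * (ν K (a K) t τ univ).toReal) :=
            mul_le_mul_of_nonneg_left (hdomL K t ht τ hτ) hM₂.le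
        _ = (1 - q) * (ν K (a K) t τ univ).toReal := by
            rw [← mul_assoc, div_mul_cancel₀ _ hM₃.ne']
        _ ≤ _ := h1
    show (1 - q) / M₃ * ((∑ τ ∈ (T K).filter (fun τ => s ∈ small K τ), νbar K (a K) τ) univ).toReal ≤ _
    rw [Measure.finsetSum_apply, ENNReal.toReal_sum (fun τ _ => measure_ne_top _ _), Finset.mul_sum]
    calc ∑ τ ∈ (T K).filter (fun τ => s ∈ small K τ), (1 - q) / M₃ * (νbar K (a K) τ univ).toReal
        ≤ ∑ τ ∈ (T K).filter (fun τ => s ∈ small K τ),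
            histWeight (ν K (a K) t τ) (small K τ) (u K) (fun s => a K (lvl K s)) :=
          Finset.sum_le_sum fun τ hτ => hterm τ (Finset.mem_filter.1 hτ).1
      _ ≤ ∑ τ ∈ T K, histWeight (ν K (a K) t τ) (small K τ) (u K) (fun s => a K (lvl K s)) :=
          Finset.sum_le_sum_of_subset_of_nonneg (Finset.filter_subset _ _)
            fun τ _ _ => histWeight_nonneg _ _ _ _

end OneRun

end Summit.QuantumFields.YangMills.Theorems.N21HistoriesTermDominants
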